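import Summits.ResolutionOfSingularities.ResolutionOfSingularities.Theorems.UniformComplexityCampaignW82SpecializationNormalForms
import Summits.ResolutionOfSingularities.ResolutionOfSingularities.Theorems.UniformComplexityPrimeModelTransferSpecialization
import Summits.ResolutionOfSingularities.ResolutionOfSingularities.Theorems.UniformComplexityPrimeModelTransferAlgClosedTower
import Mathlib.FieldTheory.IsAlgClosed.AlgebraicClosure
import Mathlib.FieldTheory.IntermediateField.Adjoin.Algebra
import Mathlib.RingTheory.AlgebraicIndependent.TranscendenceBasis
import Mathlib.RingTheory.AlgebraicIndependent.Transcendental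
import Mathlib.Algebra.CharP.IntermediateField
import Mathlib.Algebra.Algebra.ZMod
import HarnessLib

/-!
# Crux `PrimeModelTransfer` (stmt-ResolutionOfSingularities-8933), door 2 of slot W8.2:
# the TRANSCENDENCE-DEGREE LADDER normal form (`CampaignW82.LevelClimb`), by name

Route `ResolutionOfSingularities/UniformComplexity`. The typer's ladder statements
(Theorems/UniformComplexityCampaignW82SpecializationNormalForms.lean, p481773):
`ResAlgClosedTrdegLe p d` (resolution over every algebraically closed field of characteristic `p`
of transcendence degree `≤ d` over its prime subfield) and `LevelClimb p`
(`∀ d, ResAlgClosedTrdegLe p d → ResAlgClosedTrdegLe p (d + 1)`). Proved here BY NAME: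

* `resAlgClosedTrdegLe_zero_iff_primeClosureRes` — level `0` IS the crux hypothesis (the
  algebraically closed fields of transcendence degree `0` over `𝔽_p` are those algebraic over
  `𝔽_p`, i.e. satisfying the crux's clause `∀ x, ∃ n > 0, x^(p^n) = x`);
* `algClosedRes_of_forall_resAlgClosedTrdegLe` — all levels give the crux conclusion (every finite
  subset of an algebraically closed `K` lies in an algebraically closed subfield of finite
  transcendence degree, `trdeg_bot_algebraicClosure_adjoin_le`, and resolution descends from these
  perfect subfields, `PrimeModelTransfer.hasResolution_of_perfectSubfields`, p470438);
* `primeModelTransferAt_iff_levelClimb` — for prime `p`, **the crux's `p`-slice is EQUIVALENT to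
  the ladder `R_{≤d} ⇒ R_{≤d+1}` for all `d`** (→ through `resAlgClosedTrdegLe_anti` and
  `resAlgClosedTrdegLe_of_algClosedRes`; ← by level induction).

Auxiliary: `trdeg_le_trdeg_of_comp_eq` (the transcendence degree does not increase when the base
ring is enlarged along an injective map), `isAlgebraic_zmod_iff_isAlgebraic_bot` (algebraicity
over `ZMod p` = over the prime subfield).

[OURS · LADDER-RESOLUTION L1, slot W8.2 (prime-field / universality transfer), door 2
UniformComplexity] By-name links; NOT statements of, and attributing nothing to, Hironaka's 2017
manuscript. AI-written; weaker than expert review. Theses-free module.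
-/

noncomputable section

set_option linter.dupNamespace false -- mandated namespace of this single-conjunct summit

open CategoryTheory CategoryTheory.Limits AlgebraicGeometry TopologicalSpace
open Literature.AlgebraicGeometry.Resolution
open scoped Cardinal IntermediateField.algebraAdjoinAdjoin

namespace Summit.ResolutionOfSingularities.ResolutionOfSingularities.Theorems.CampaignW82

/-! ## Transcendence degree under change of the base ring; the prime subfield -/

/-- **`trdeg_S A ≤ trdeg_R A` along an injective `f : R → S` compatible with the algebra maps**:
an `S`-algebraically independent family is `R`-algebraically independent
(Mathlib `AlgebraicIndependent.of_ringHom_of_comp_eq`). [folklore] -/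
theorem trdeg_le_trdeg_of_comp_eq {R S A : Type} [CommRing R] [Nontrivial R] [CommRing S]
    [CommRing A] [Algebra R A] [Algebra S A] (f : R →+* S) (hf : Function.Injective f)
    (h : (algebraMap S A).comp f = algebraMap R A) : Algebra.trdeg S A ≤ Algebra.trdeg R A := by
  change (⨆ ι : { s : Set A // AlgebraicIndepOn S _root_.id s }, Cardinal.mk ι.1) ≤ _
  refine ciSup_le' fun i => ?_
  have H : AlgebraicIndependent S ((RingHom.id A) ∘ fun j : i.1 => (j : A)) := i.2
  have h' : (algebraMap S A).comp (f : R →+* S) =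
      ((RingHom.id A : A →+* A)).comp (algebraMap R A) := by
    rw [RingHom.id_comp]; exact h
  exact (H.of_ringHom_of_comp_eq f (RingHom.id A) hf h').cardinalMk_le_trdeg

/-- The canonical SURJECTION `ZMod p → (⊥ : Subfield Ω)` onto the prime subfield of a field of
characteristic `p`, with its compatibility. [folklore] -/
theorem exists_ringHom_zmod_bot (p : ℕ) [Fact p.Prime] (Ω : Type) [Field Ω] [CharP Ω p]
    [Algebra (ZMod p) Ω] :
    ∃ f : ZMod p →+* (⊥ : Subfield Ω), Function.Surjective f ∧ Function.Injective f ∧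
      (algebraMap (⊥ : Subfield Ω) Ω).comp f = algebraMap (ZMod p) Ω := by
  have hmem : ∀ a : ZMod p, algebraMap (ZMod p) Ω a ∈ (⊥ : Subfield Ω) := fun a => by
    rw [← ZMod.natCast_zmod_val a, map_natCast]
    exact natCast_mem _ _
  let f : ZMod p →+* (⊥ : Subfield Ω) := (algebraMap (ZMod p) Ω).codRestrict _ hmem
  refine ⟨f, fun z => ?_, f.injective, RingHom.ext fun _ => rfl⟩
  have hz : (z : Ω) ∈ (algebraMap (ZMod p) Ω).fieldRange :=
    bot_le (a := (algebraMap (ZMod p) Ω).fieldRange) z.2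
  obtain ⟨a, ha⟩ := RingHom.mem_fieldRange.mp hz
  exact ⟨a, Subtype.ext ha⟩

/-- **Algebraic over `ZMod p` ⟺ algebraic over the prime subfield.** [folklore] -/
theorem isAlgebraic_zmod_iff_isAlgebraic_bot (p : ℕ) [Fact p.Prime] (Ω : Type) [Field Ω]
    [CharP Ω p] [Algebra (ZMod p) Ω] :
    Algebra.IsAlgebraic (ZMod p) Ω ↔ Algebra.IsAlgebraic (⊥ : Subfield Ω) Ω := by
  obtain ⟨f, hfs, hfi, hcomp⟩ := exists_ringHom_zmod_bot p Ω
  have hcomp' : (algebraMap (⊥ : Subfield Ω) Ω).comp (f : ZMod p →+* (⊥ : Subfield Ω)) =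
      ((RingHom.id Ω : Ω →+* Ω)).comp (algebraMap (ZMod p) Ω) := by
    rw [RingHom.id_comp]; exact hcomp
  constructor
  · intro h
    exact Algebra.IsAlgebraic.ringHom_of_comp_eq f (RingHom.id Ω) hfi Function.surjective_id hcomp'
  · intro h
    exact Algebra.IsAlgebraic.of_ringHom_of_comp_eq f (RingHom.id Ω) hfs Function.injective_id
      hcomp'

/-- **Transcendence degree `≤ 0` over the prime subfield ⟺ the crux's algebraicity clause** for a
field of characteristic `p` (`x ^ p ^ n = x` for some `n ≥ 1`, for every `x`). [folklore] -/
theorem trdeg_bot_le_zero_iff_forall_pow (p : ℕ) [Fact p.Prime] (k : Type) [Field k] [CharP k p] :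
    Algebra.trdeg (⊥ : Subfield k) k ≤ 0 ↔ ∀ x : k, ∃ n : ℕ, 0 < n ∧ x ^ p ^ n = x := by
  letI : Algebra (ZMod p) k := ZMod.algebra k p
  rw [nonpos_iff_eq_zero, trdeg_eq_zero_iff, ← isAlgebraic_zmod_iff_isAlgebraic_bot]
  constructor
  · intro h x
    exact PrimeModelTransfer.pow_prime_pow_eq_self_of_isAlgebraic p x (h.isAlgebraic x)
  · intro hk
    refine ⟨fun x => ?_⟩
    obtain ⟨n, hn, hx⟩ := hk x
    have hdeg : 1 < p ^ n := Nat.one_lt_pow hn.ne' (Fact.out : p.Prime).one_lt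
    refine ⟨Polynomial.X ^ (p ^ n) - Polynomial.X, ?_, ?_⟩
    · intro h
      have := congrArg Polynomial.natDegree h
      rw [Polynomial.natDegree_sub_eq_left_of_natDegree_lt (by simpa using hdeg),
        Polynomial.natDegree_X_pow, Polynomial.natDegree_zero] at this
      exact (Nat.pos_of_ne_zero (by omega) |>.ne') this |>.elim
    · simp [hx]

/-! ## Level zero is the crux hypothesis -/

/-- **`ResAlgClosedTrdegLe p 0 ⟺ PrimeClosureRes p`** for prime `p`: the algebraically closed
fields of characteristic `p` of transcendence degree `0` over their prime subfield are exactly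
those satisfying the crux's algebraicity clause. [folklore] -/
theorem resAlgClosedTrdegLe_zero_iff_primeClosureRes {p : ℕ} (hp : p.Prime) :
    ResAlgClosedTrdegLe p 0 ↔ PrimeClosureRes p := by
  haveI : Fact p.Prime := ⟨hp⟩
  constructor
  · intro h k _ _ _ hk X f hs hl hq hX
    exact h k (by exact_mod_cast (trdeg_bot_le_zero_iff_forall_pow p k).mpr hk) X f hs hl hq hX
  · intro h k _ _ _ hk X f hs hl hq hX
    exact h k ((trdeg_bot_le_zero_iff_forall_pow p k).mp (by exact_mod_cast hk)) X f hs hl hq hX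

/-! ## Finite subsets lie in algebraically closed subfields of finite transcendence degree -/

/-- **`trdeg ((𝔽_p(s))^{alg} ∩ K) ≤ |s|` over the prime subfield**: the algebraic closure `A` in
`K` of the subfield generated by a finite `s ⊆ K` is algebraic over `𝔽_p[s]`, so
`trdeg_{𝔽_p} A ≤ |s|` (Mathlib `trdeg_le_cardinalMk`, after transporting algebraicity from
`𝔽_p[s] ⊆ K` to `𝔽_p[s] ⊆ A`), and the prime subfield contains the image of `ZMod p`
(`trdeg_le_trdeg_of_comp_eq`). [folklore] -/
theorem trdeg_bot_algebraicClosure_adjoin_le (p : ℕ) [Fact p.Prime] (K : Type) [Field K]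
    [CharP K p] (s : Finset K) :
    letI : Algebra (ZMod p) K := ZMod.algebra K p
    Algebra.trdeg
        (⊥ : Subfield (algebraicClosure (IntermediateField.adjoin (ZMod p) (↑s : Set K)) K))
        (algebraicClosure (IntermediateField.adjoin (ZMod p) (↑s : Set K)) K) ≤ s.card := by
  classical
  letI : Algebra (ZMod p) K := ZMod.algebra K p
  let E : IntermediateField (ZMod p) K := IntermediateField.adjoin (ZMod p) (↑s : Set K)
  let A : IntermediateField E K := algebraicClosure E K
  let D : Subalgebra (ZMod p) K := Algebra.adjoin (ZMod p) (↑s : Set K)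
  haveI : CharP A p := (algebraMap A K).charP (algebraMap A K).injective p
  -- `A` is algebraic over `D = 𝔽_p[s] ⊆ K`
  letI : Algebra D A := ((algebraMap E A).comp (algebraMap D E)).toAlgebra
  haveI : IsScalarTower D E A := IsScalarTower.of_algebraMap_eq fun _ => rfl
  haveI : Algebra.IsAlgebraic E A := algebraicClosure.isAlgebraic E K
  haveI : Algebra.IsAlgebraic D A := Algebra.IsAlgebraic.trans D E A
  -- the same generators seen in `A`, and `D' = 𝔽_p[s'] ⊆ A`
  let s' : Set A := Subtype.val ⁻¹' (↑s : Set K)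
  have hsA : ∀ x : K, x ∈ (↑s : Set K) → x ∈ (A.toSubfield : Set K) := fun x hx => by
    have := A.algebraMap_mem (⟨x, IntermediateField.subset_adjoin _ _ hx⟩ : E)
    simpa using this
  let D' : Subalgebra (ZMod p) A := Algebra.adjoin (ZMod p) s'
  let v : A →ₐ[ZMod p] K := (A.val).restrictScalars (ZMod p)
  have himg : (v : A → K) '' s' = (↑s : Set K) := by
    ext y
    constructor
    · rintro ⟨z, hz, rfl⟩; exact hz
    · intro hy; exact ⟨⟨y, hsA y hy⟩, hy, rfl⟩
  have hmap : D'.map v = D := by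
    change (Algebra.adjoin (ZMod p) s').map v = Algebra.adjoin (ZMod p) (↑s : Set K)
    rw [AlgHom.map_adjoin, himg]
  have hmem : ∀ d' : D', ((v : A →+* K).comp (D'.val : D' →+* A)) d' ∈ D := fun d' => by
    rw [← hmap]; exact Subalgebra.mem_map.mpr ⟨d', d'.2, rfl⟩
  let f : D' →+* D := ((v : A →+* K).comp (D'.val : D' →+* A)).codRestrict D hmem
  have hf : Function.Surjective f := by
    rintro ⟨d, hd⟩
    rw [← hmap] at hd
    obtain ⟨a, ha, rfl⟩ := Subalgebra.mem_map.mp hd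
    exact ⟨⟨a, ha⟩, Subtype.ext rfl⟩
  have hcomp : (algebraMap D A).comp f = (RingHom.id A).comp (algebraMap D' A) :=
    RingHom.ext fun d' => Subtype.ext rfl
  haveI : Algebra.IsAlgebraic D' A :=
    Algebra.IsAlgebraic.of_ringHom_of_comp_eq f (RingHom.id A) hf Function.injective_id hcomp
  -- `trdeg_{𝔽_p} A ≤ #s' ≤ |s|`
  have h1 : Algebra.trdeg (ZMod p) A ≤ Cardinal.mk s' :=
    Algebra.IsAlgebraic.trdeg_le_cardinalMk (ZMod p) s'
  have h2 : Cardinal.mk s' ≤ (s.card : Cardinal) := by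
    rw [← Cardinal.mk_coe_finset]
    exact Cardinal.mk_preimage_of_injective _ _ Subtype.val_injective
  -- over the prime subfield
  obtain ⟨g, -, hgi, hgcomp⟩ := exists_ringHom_zmod_bot p A
  exact (trdeg_le_trdeg_of_comp_eq g hgi hgcomp).trans (h1.trans h2)

/-- **All levels give the crux conclusion**: if resolution holds over every algebraically closed
field of characteristic `p` of finite transcendence degree over its prime subfield (every level
`ResAlgClosedTrdegLe p d`), then it holds over every algebraically closed field of characteristic
`p` — descent from the algebraically closed subfields `(𝔽_p(s))^{alg} ∩ K`, `s` finite
(`PrimeModelTransfer.hasResolution_of_perfectSubfields`, p470438), which have transcendence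
degree `≤ |s|` (`trdeg_bot_algebraicClosure_adjoin_le`). [folklore] -/
theorem algClosedRes_of_forall_resAlgClosedTrdegLe {p : ℕ} (hp : p.Prime)
    (h : ∀ d : ℕ, ResAlgClosedTrdegLe p d) : AlgClosedRes p := by
  haveI : Fact p.Prime := ⟨hp⟩
  intro K _ _ _ X f hs hl hq hX
  classical
  haveI : PerfectField K := IsAlgClosed.perfectField K
  letI : Algebra (ZMod p) K := ZMod.algebra K p
  refine PrimeModelTransfer.hasResolution_of_perfectSubfields K (fun s => ?_) X f hs hl hq hX
  let E : IntermediateField (ZMod p) K := IntermediateField.adjoin (ZMod p) (↑s : Set K)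
  let A : IntermediateField E K := algebraicClosure E K
  haveI : IsAlgClosed A := IsAlgClosure.isAlgClosed E
  haveI : CharP A p := (algebraMap A K).charP (algebraMap A K).injective p
  refine ⟨A.toSubfield, fun y hy => ?_, inferInstanceAs (PerfectField A), ?_⟩
  · have := A.algebraMap_mem (⟨y, IntermediateField.subset_adjoin _ _ hy⟩ : E)
    simpa using this
  · exact fun Y g hs' hl' hq' hY =>
      h s.card A (trdeg_bot_algebraicClosure_adjoin_le p K s) Y g hs' hl' hq' hY

/-! ## The ladder normal form -/

/-- **`PrimeModelTransferAt p ⟺ LevelClimb p`** for prime `p`: the crux's `p`-slice is EQUIVALENT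
to the transcendence-degree ladder `R_{≤ d} ⇒ R_{≤ d+1}` (all `d`). (→: `R_{≤ d}` gives `R_{≤ 0}`
(`resAlgClosedTrdegLe_anti`), i.e. the crux hypothesis
(`resAlgClosedTrdegLe_zero_iff_primeClosureRes`), so the crux gives `AlgClosedRes p`, hence
`R_{≤ d+1}`; ←: the crux hypothesis is `R_{≤ 0}`, level
induction gives every level, and `algClosedRes_of_forall_resAlgClosedTrdegLe` concludes.)
[folklore] -/
theorem primeModelTransferAt_iff_levelClimb {p : ℕ} (hp : p.Prime) :
    PrimeModelTransferAt p ↔ LevelClimb p := by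
  constructor
  · intro h d hd
    exact resAlgClosedTrdegLe_of_algClosedRes
      (h ((resAlgClosedTrdegLe_zero_iff_primeClosureRes hp).mp
        (resAlgClosedTrdegLe_anti d.zero_le hd))) (d + 1)
  · intro h hA
    exact algClosedRes_of_forall_resAlgClosedTrdegLe hp
      (forall_resAlgClosedTrdegLe_of_zero_of_levelClimb
        ((resAlgClosedTrdegLe_zero_iff_primeClosureRes hp).mpr hA) h)

end Summit.ResolutionOfSingularities.ResolutionOfSingularities.Theorems.CampaignW82

end
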